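import Literature.Analysis.FluidPDE.KochTataruLinear
import HarnessLib

/-!
# The heat flow preserves `BMO⁻¹` (docstring to be completed)
-/

noncomputable section

open MeasureTheory Set Function Filter Topology Metric Real
open scoped ENNReal NNReal RealInnerProductSpace

namespace Literature.Analysis.FluidPDE

variable {E : Type*} [NormedAddCommGroup E] [InnerProductSpace ℝ E] [FiniteDimensional ℝ E]
  [MeasurableSpace E] [BorelSpace E]

/-! ## Time-shifted Carleson boxes of a caloric extension -/

section Boxes

/-- Translating the time variable of a box integral: `∫_{(0,R²)} F(t + τ) dτ = ∫_{(t, t+R²)} F`.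
[folklore] -/
theorem setLIntegral_Ioo_comp_add (F : ℝ → ℝ≥0∞) (t R : ℝ) :
    ∫⁻ τ in Ioo 0 (R ^ 2), F (t + τ) = ∫⁻ σ in Ioo t (t + R ^ 2), F σ := by
  have h := (measurePreserving_add_right volume t).setLIntegral_comp_preimage_emb
    (measurableEmbedding_addRight t) F (Ioo t (t + R ^ 2))
  rw [preimage_add_const_Ioo, sub_self, add_sub_cancel_left] at h
  simpa only [add_comm _ t] using h

/-- **Carleson boxes of a time-shifted caloric extension** (Koch–Tataru 2001, (2)–(3): the
`BMO⁻¹` norm is a supremum over boxes `B(x,R) × (0, R²)`): for a tempered `u` with finite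
Carleson quantity `γ = sup_{x,R} R^{-d}∫₀^{R²}∫_{B(x,R)}|e^{sΔ}u|²`, the time-shifted boxes are
uniformly bounded,
`R^{-d} ∫₀^{R²}∫_{B(x,R)} |e^{(t+τ)Δ}u|² dy dτ ≤ max (|B(0,1)| C γ) (2^d γ)` for all `t > 0`,
`x`, `R > 0`: boxes with `R² ≤ t` are controlled by the pointwise bound (22)
`|e^{sΔ}u|² ≤ Cγ/s` (`exists_sq_heatExtension_le`), boxes with `R² > t` sit inside the box of
radius `√(t + R²) < √2 R` starting at time `0`. [cite: KochTataruAdvMath2001, §1 (2)–(3) and (22)] -/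
theorem exists_shifted_box_le :
    ∃ C : ℝ, 0 ≤ C ∧ ∀ {u : E → ℝ} {K : ℕ},
      Integrable (fun w => ((1 + ‖w‖) ^ K)⁻¹ * u w) →
      FunctionSpaces.BMOInv.eCarlesonNorm u < ∞ → ∀ {t : ℝ}, 0 < t → ∀ (x : E) {R : ℝ}, 0 < R →
        (ENNReal.ofReal (R ^ Module.finrank ℝ E))⁻¹ *
            ∫⁻ τ in Ioo 0 (R ^ 2), ∫⁻ y in ball x R,
              ‖FunctionSpaces.BMOInv.heatExtension u (t + τ) y‖ₑ ^ 2 ≤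
          max (volume (ball (0 : E) 1) * ENNReal.ofReal (C * (FunctionSpaces.BMOInv.eCarlesonNorm u).toReal))
            (2 ^ Module.finrank ℝ E * FunctionSpaces.BMOInv.eCarlesonNorm u) := by
  obtain ⟨C, hC, hsq⟩ := FunctionSpaces.BMOInv.exists_sq_heatExtension_le (E := E)
  refine ⟨C, hC, fun {u K} hfw hγ {t} ht x {R} hR => ?_⟩
  set d : ℕ := Module.finrank ℝ E with hd
  set γ := FunctionSpaces.BMOInv.eCarlesonNorm u with hγdef
  set c : ℝ≥0∞ := ENNReal.ofReal (R ^ d) with hc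
  have hc0 : c ≠ 0 := (ENNReal.ofReal_pos.2 (by positivity)).ne'
  have hctop : c ≠ ⊤ := ENNReal.ofReal_ne_top
  rcases le_or_gt (R ^ 2) t with hRt | hRt
  · -- small boxes: the pointwise bound (22)
    refine le_trans ?_ (le_max_left _ _)
    have hpt : ∀ τ ∈ Ioo (0 : ℝ) (R ^ 2), ∀ y,
        ‖FunctionSpaces.BMOInv.heatExtension u (t + τ) y‖ₑ ^ 2 ≤ ENNReal.ofReal (C * γ.toReal / t) := by
      intro τ hτ y
      have htτ : 0 < t + τ := by linarith [hτ.1]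
      have h := hsq hfw hγ htτ y
      rw [← enorm_pow, Real.enorm_eq_ofReal (sq_nonneg _)]
      refine ENNReal.ofReal_le_ofReal (h.trans ?_)
      exact div_le_div_of_nonneg_left (by positivity) ht (by linarith [hτ.1])
    calc c⁻¹ * ∫⁻ τ in Ioo 0 (R ^ 2), ∫⁻ y in ball x R, ‖FunctionSpaces.BMOInv.heatExtension u (t + τ) y‖ₑ ^ 2
        ≤ c⁻¹ * ∫⁻ τ in Ioo 0 (R ^ 2), ∫⁻ y in ball x R, ENNReal.ofReal (C * γ.toReal / t) := by
          gcongr c⁻¹ * ?_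
          exact setLIntegral_mono' measurableSet_Ioo fun τ hτ =>
            setLIntegral_mono' measurableSet_ball fun y _ => hpt τ hτ y
      _ = c⁻¹ * (ENNReal.ofReal (C * γ.toReal / t) * (c * volume (ball (0 : E) 1)) * ENNReal.ofReal (R ^ 2)) := by
          rw [setLIntegral_const, setLIntegral_const, Measure.addHaar_ball_of_pos _ x hR, Real.volume_Ioo,
            sub_zero]
      _ = volume (ball (0 : E) 1) * (ENNReal.ofReal (C * γ.toReal / t) * ENNReal.ofReal (R ^ 2)) := by
          calc c⁻¹ * (ENNReal.ofReal (C * γ.toReal / t) * (c * volume (ball (0 : E) 1)) * ENNReal.ofReal (R ^ 2))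
              = (c⁻¹ * c) * volume (ball (0 : E) 1) *
                  (ENNReal.ofReal (C * γ.toReal / t) * ENNReal.ofReal (R ^ 2)) := by ring
            _ = _ := by rw [ENNReal.inv_mul_cancel hc0 hctop, one_mul]
      _ ≤ volume (ball (0 : E) 1) * ENNReal.ofReal (C * γ.toReal) := by
          gcongr
          rw [← ENNReal.ofReal_mul (by positivity)]
          refine ENNReal.ofReal_le_ofReal ?_
          rw [div_mul_eq_mul_div, div_le_iff₀ ht]
          exact mul_le_mul_of_nonneg_left hRt (by positivity)
  · -- large boxes: inside the box of radius `√(t + R²)` from time `0`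
    refine le_trans ?_ (le_max_right _ _)
    set R' : ℝ := Real.sqrt (t + R ^ 2) with hR'
    have hR'0 : 0 < R' := Real.sqrt_pos.2 (by positivity)
    have hR'sq : R' ^ 2 = t + R ^ 2 := Real.sq_sqrt (by positivity)
    have hRR' : R ≤ R' := by
      rw [hR', Real.le_sqrt hR.le (by positivity)]; linarith
    have hR'2 : R' ^ d ≤ 2 ^ d * R ^ d := by
      have h1 : R' ≤ 2 * R := by
        rw [hR', Real.sqrt_le_left (by positivity)]; nlinarith
      calc R' ^ d ≤ (2 * R) ^ d := pow_le_pow_left₀ hR'0.le h1 d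
        _ = 2 ^ d * R ^ d := mul_pow _ _ _
    calc c⁻¹ * ∫⁻ τ in Ioo 0 (R ^ 2), ∫⁻ y in ball x R, ‖FunctionSpaces.BMOInv.heatExtension u (t + τ) y‖ₑ ^ 2
        = c⁻¹ * ∫⁻ σ in Ioo t (t + R ^ 2), ∫⁻ y in ball x R, ‖FunctionSpaces.BMOInv.heatExtension u σ y‖ₑ ^ 2 := by
          rw [setLIntegral_Ioo_comp_add (fun σ => ∫⁻ y in ball x R,
            ‖FunctionSpaces.BMOInv.heatExtension u σ y‖ₑ ^ 2) t R]
      _ ≤ c⁻¹ * ∫⁻ σ in Ioo 0 (R' ^ 2), ∫⁻ y in ball x R', ‖FunctionSpaces.BMOInv.heatExtension u σ y‖ₑ ^ 2 := by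
          gcongr c⁻¹ * ?_
          calc ∫⁻ σ in Ioo t (t + R ^ 2), ∫⁻ y in ball x R, ‖FunctionSpaces.BMOInv.heatExtension u σ y‖ₑ ^ 2
              ≤ ∫⁻ σ in Ioo 0 (R' ^ 2), ∫⁻ y in ball x R, ‖FunctionSpaces.BMOInv.heatExtension u σ y‖ₑ ^ 2 :=
                lintegral_mono_set (Ioo_subset_Ioo ht.le (by rw [hR'sq]))
            _ ≤ _ := lintegral_mono fun σ => lintegral_mono_set (ball_subset_ball hRR')
      _ ≤ c⁻¹ * (γ * ENNReal.ofReal (R' ^ d)) := by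
          gcongr
          exact FunctionSpaces.BMOInv.lintegral_box_le_eCarlesonNorm u x hR'0
      _ ≤ c⁻¹ * (γ * (2 ^ d * c)) := by
          gcongr
          calc ENNReal.ofReal (R' ^ d) ≤ ENNReal.ofReal (2 ^ d * R ^ d) := ENNReal.ofReal_le_ofReal hR'2
            _ = 2 ^ d * c := by
                rw [ENNReal.ofReal_mul (by positivity), ENNReal.ofReal_pow (by norm_num), ENNReal.ofReal_ofNat]
      _ = 2 ^ d * γ := by
          calc c⁻¹ * (γ * (2 ^ d * c)) = (c⁻¹ * c) * (2 ^ d * γ) := by ring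
            _ = 2 ^ d * γ := by rw [ENNReal.inv_mul_cancel hc0 hctop, one_mul]

end Boxes

/-! ## `e^{tΔ}` preserves `BMO⁻¹` -/

section HeatSlice

/-- **The heat flow preserves `BMO⁻¹`** (Koch–Tataru 2001, Theorem 1 with (2)–(3): in the
Carleson description `BMO⁻¹ = {u : sup_{x,R} R^{-d}∫₀^{R²}∫_{B(x,R)}|e^{sΔ}u|² < ∞}` and
`e^{sΔ}e^{tΔ}u = e^{(s+t)Δ}u`, so the boxes of `e^{tΔ}u` are time-shifted boxes of `u`): for a
polynomially tempered `u ∈ BMO⁻¹(E)` and `t > 0`, `e^{tΔ}u ∈ BMO⁻¹(E)` (Koch–Tataru's Theorem 1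
in both directions, `memBMOInv_iff_carleson_heat_holds`, and `exists_shifted_box_le`).
[cite: KochTataruAdvMath2001, Theorem 1 and §1 (2)–(3)] -/
theorem _root_.Literature.Analysis.FunctionSpaces.MemBMOInv.heatExtension {u : E → ℝ}
    (hu : FunctionSpaces.MemBMOInv u)
    (htemp : ∃ N : ℕ, Integrable fun y => ((1 + ‖y‖ ^ 2) ^ N)⁻¹ * u y) {t : ℝ} (ht : 0 < t) :
    FunctionSpaces.MemBMOInv (fun y => FunctionSpaces.BMOInv.heatExtension u t y) := by
  obtain ⟨N, hN⟩ := htemp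
  obtain ⟨Φ, -, hrep⟩ := id hu
  have hl : LocallyIntegrable u := hrep.locallyIntegrable
  have hγ : FunctionSpaces.BMOInv.eCarlesonNorm u < ∞ :=
    (FunctionSpaces.memBMOInv_iff_carleson_heat_holds hl ⟨N, hN⟩).1 hu
  have hfw := FunctionSpaces.BMOInv.integrable_growth_of_tempered hN
  set f : E → ℝ := fun y => FunctionSpaces.BMOInv.heatExtension u t y with hf
  -- `f` is bounded and measurable
  obtain ⟨C₁, hC₁, habs⟩ := FunctionSpaces.BMOInv.exists_abs_heatExtension_le (E := E)
  set M : ℝ := C₁ * Real.sqrt (FunctionSpaces.BMOInv.eCarlesonNorm u).toReal / Real.sqrt t with hM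
  have hfM : ∀ y, |f y| ≤ M := fun y => habs hfw hγ ht y
  have hfm : Measurable f :=
    (FunctionSpaces.BMOInv.measurable_heatExtension (FunctionSpaces.BMOInv.aestronglyMeasurable_of_growth hfw)).comp
      (measurable_const.prodMk measurable_id)
  have hftop : MemLp f ∞ volume :=
    memLp_top_of_bound hfm.aestronglyMeasurable M (Eventually.of_forall fun y => by
      rw [Real.norm_eq_abs]; exact hfM y)
  have hfl : LocallyIntegrable f := hftop.locallyIntegrable le_top
  -- `f` is tempered
  set N' : ℕ := Module.finrank ℝ E + 1 with hN'
  have hwint : Integrable fun y : E => ((1 + ‖y‖ ^ 2) ^ N' : ℝ)⁻¹ := by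
    have h := integrable_rpow_neg_one_add_norm_sq (E := E) (μ := volume) (r := 2 * N')
      (by rw [hN']; push_cast; linarith)
    refine h.congr (Eventually.of_forall fun y => ?_)
    simp only
    rw [show -(2 * (N' : ℝ)) / 2 = -(N' : ℝ) by ring, Real.rpow_neg (by positivity), Real.rpow_natCast]
  have hftemp : ∃ N : ℕ, Integrable fun y => ((1 + ‖y‖ ^ 2) ^ N)⁻¹ * f y := by
    refine ⟨N', (hwint.mul_const M).mono' (hwint.aestronglyMeasurable.mul hfm.aestronglyMeasurable)
      (Eventually.of_forall fun y => ?_)⟩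
    rw [norm_mul, Real.norm_of_nonneg (by positivity), Real.norm_eq_abs]
    exact mul_le_mul_of_nonneg_left (hfM y) (by positivity)
  -- the Carleson quantity of `f`
  obtain ⟨C, hC, hbox⟩ := exists_shifted_box_le (E := E)
  set Λ : ℝ≥0∞ := max (volume (ball (0 : E) 1) *
      ENNReal.ofReal (C * (FunctionSpaces.BMOInv.eCarlesonNorm u).toReal))
    (2 ^ Module.finrank ℝ E * FunctionSpaces.BMOInv.eCarlesonNorm u) with hΛ
  have hΛtop : Λ < ∞ := by
    refine max_lt (ENNReal.mul_lt_top measure_ball_lt_top ENNReal.ofReal_lt_top) ?_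
    exact ENNReal.mul_lt_top (ENNReal.pow_lt_top ENNReal.ofNat_lt_top) hγ
  have hsemigroup : ∀ {τ : ℝ}, 0 < τ → ∀ y,
      FunctionSpaces.BMOInv.heatExtension f τ y = FunctionSpaces.BMOInv.heatExtension u (t + τ) y := by
    intro τ hτ y
    rw [FunctionSpaces.BMOInv.heatExtension_add_eq_integral hfw ht hτ y]
    rfl
  have hcarl : FunctionSpaces.BMOInv.eCarlesonNorm f ≤ Λ := by
    refine iSup_le fun x => iSup₂_le fun R hR => ?_
    have hcongr : ∫⁻ τ in Ioo 0 (R ^ 2), ∫⁻ y in ball x R, ‖FunctionSpaces.BMOInv.heatExtension f τ y‖ₑ ^ 2 =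
        ∫⁻ τ in Ioo 0 (R ^ 2), ∫⁻ y in ball x R, ‖FunctionSpaces.BMOInv.heatExtension u (t + τ) y‖ₑ ^ 2 :=
      setLIntegral_congr_fun measurableSet_Ioo fun τ hτ => by simp only [hsemigroup hτ.1]
    rw [hcongr]
    exact hbox hfw hγ ht x hR
  exact FunctionSpaces.memBMOInv_of_eCarlesonNorm_lt_top hfl hftemp (hcarl.trans_lt hΛtop)

/-- **The caloric extension of tempered `BMO⁻¹` data has `BMO⁻¹` slices** (vector form;
Koch–Tataru 2001, Theorem 1 with (2)–(3), componentwise via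
`inner_heatExtension_eq_heatExtension_inner`): for `u₀ ∈ BMO⁻¹(E; E)` polynomially tempered and
`t > 0`, `e^{tΔ}u₀ ∈ BMO⁻¹(E; E)`. [cite: KochTataruAdvMath2001, Theorem 1 and §1 (2)–(3)] -/
theorem _root_.Literature.Analysis.FunctionSpaces.MemBMOInvVec.heatExtension {u₀ : E → E}
    (hu : FunctionSpaces.MemBMOInvVec u₀) (htemp : IsPolynomiallyTempered u₀) {t : ℝ} (ht : 0 < t) :
    FunctionSpaces.MemBMOInvVec (fun x => UnboundedOperators.heatExtension u₀ t x) := by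
  intro v
  have heq : (fun x => ⟪UnboundedOperators.heatExtension u₀ t x, v⟫) =
      fun x => FunctionSpaces.BMOInv.heatExtension (fun z => ⟪u₀ z, v⟫) t x :=
    funext fun x => inner_heatExtension_eq_heatExtension_inner htemp ht x v
  rw [heq]
  exact (hu v).heatExtension (htemp.inner_const v) ht

end HeatSlice

end Literature.Analysis.FluidPDE
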